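import Summits.QuantumFields.YangMills.Theorems.UnitScaleTiltProp7SectET3BgClass
import Literature.MathematicalPhysics.QuantumFieldTheory.Balaban1983to89.B9
import Literature.MathematicalPhysics.QuantumFieldTheory.Balaban1983to89.B11Eq115Space
import Literature.MathematicalPhysics.QuantumFieldTheory.Balaban1983to89.T3PrintedMinimiserExistence
import HarnessLib

/-!
# Route `UnitScaleTilt`, crux «MinimiserStabilityRegPr» (stmt-QuantumFields-19200, v10 stub EX, route (α), node N06(d = 3)) — layer (S3-b), the `norm_G` HALF OF THE KNIT:
# **`SectEDatum.norm_G` ∕ the displayed `norm_G` row of `Cmin_of_P6T3_chart_growth_pd` FROM `B9.Thm313Printed`'S GLOBAL CLAUSE (3.47)₁ AT `γ = −3`**, generic and at the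
# T³ member of record (`geo9K`, `bgT3`, `memberIdx`, the route's field read by `cfgV1OfT3`, print's regular space `RegPr` through the class-transfer row `ClassTransferT3`)

Cell `ym3-torus` (HUMAN RULING D-0037, YM ladder rung R3 — NOT the Clay problem), width seat ym-ust-20520-w1 g3.  Count-neutral helper (`--supports stmt-QuantumFields-19200 --as
helper`); registry untouched; THEOREMS ONLY (0 `def`, 0 `sorry`); NOTHING of [Balaban1985BackgroundPropagators] is asserted.

THE PRINT.  [Balaban1985Variational] (117) p. 295: *«By Theorem 3.13 of [5] we have |𝔊(U₀)λ|₍₁₁₅₎ ≦ B₀|λ|₍₋₃₎»* — the field `B11Prop6Concrete.SectEDatum.norm_G` (`∀ c, Adm c → ∀ f,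
‖G c f‖ ≤ B₀‖f‖`) and the displayed row `norm_G` of ★w2-19200 g2's `Prop7CminOfP6T3Pd.Cmin_of_P6T3_chart_growth_pd` (`RegPr … e U₀ → e ≤ α → ∀ f, ‖𝒢f i U₀ f‖ ≤ B₀‖f‖`).
[Balaban1985BackgroundPropagators] (3.47) p. 398: *«|Gλ|_{(2+γ)}, |∇_U Gλ|_{(1+γ)}, |G∇*_U λ|_{(1+γ)}, |Δ_U Gλ|_{(γ)} ≦ B₀|λ|_{(γ)} for −4 ≦ γ ≦ 4»* (the `glob` clause, third
conjunct of `B9.Ineq342_346_347_noLap`, inside `B9.Thm313Printed`); (115) p. 294 of [Balaban1985Variational]: `‖A‖₍₁₁₅₎ = max{|A|₍₋₁₎, |∇_{U₀}A|₍₋₂₎}` (`B11Eq115Space.JetSup.norm_def`).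

WHAT IS PROVED (ns `…Theorems.Prop7SectET3NormG`).
* §1 GENERIC (any index `I`, geometry `geo`, backgrounds `bg`, kernel family `GG`, any background-indexed family of maps `Gop i U : X i U → Y i U` between seminormed groups):
  ★ `normG_of_thm313Printed` — `B9.Thm313Printed c35 geo bg GG HasRWExp PosDefK` together with the TWO (3.47) PINS at `γ = −3` DISPLAYED AS INEQUALITIES (`hglob`: `‖Gop i U f‖ ≤
  max (glob 0 U (ι f) (−3)) (glob 1 U (ι f) (−3))`, i.e. the (115)-norm of `𝔊f` is read by the entries `|𝔊λ|_{(−1)}`, `|∇_U𝔊λ|_{(−2)}`; `hw`: `(geo i).wNorm (−3) (ι f) ≤ ‖f‖`, i.e.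
  the argument reading `ι` does not increase `|·|_{(−3)}`) ⟹ `∃ M₄ a₀ B₀ > 0, ∀ i, M₄ ≤ M_i → ∀ α₀ > 0, M_i·α₀ ≤ a₀ → ∀ U ∈ (3.35) ∩ (3.36), ∀ f, ‖Gop i U f‖ ≤ B₀‖f‖`;
  `normG_of_thm313Printed_jet` — the same with `Y i U := Space115 …` and the pins on the two jet components `JetSup.fst ∕ JetSup.snd` ((115) verbatim).
* §2 AT THE T³ MEMBER OF RECORD: ★★ `normG_row_of_t313_classTransfer` — §1 at `(geo9K, bgT3) ∘ KIdx 2 ℓ hd3 hL 1 1`, the background `cfgV1OfT3 U₀` of the route's SU(2) field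
  `U₀`, and ★w1 g2's class-transfer row `ClassTransferT3 ℓ hL c35` (`RegPr(L³B₃ε₁) ⊂ (3.35) ∧ (3.36)` at `memberIdx`, [Balaban1985RegularSpaces] (1.33)) ⟹ for every member
  `memberIdx ℓ hL hℓ m hm n K a' R …` whose big-block size `M = L·L^{a'}` clears the threshold `M₄` and every `e ≤ a₀ ∕ (L·L^{a'})`:
  `RegPr ⟨ℓ+1, hL, m, hm⟩ n K e U₀ → ∀ f, ‖Gop (memberIdx …) (cfgV1OfT3 U₀) f‖ ≤ B₀‖f‖` — the displayed `norm_G` row's SHAPE (`RegPr … e U₀ → e ≤ α → …`, `α := a₀∕(L·L^{a'})`).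
LOCATED (numbers, for the (S3-b) assembler).  (i) In the T³ leaf `Prop7SectET3N06Leaves.t313_of_pins_T3` (species `thm313Printed_of_step`) the (3.47) clause of `GG` is part of
the DISPLAYED RESIDUAL `hres` (`∀ n ≠ 3, −4 ≤ γ ≤ 4, (GG i).glob n U λ γ ≤ B₁·wNorm γ λ`), not derived from the letters — so along this species `norm_G`'s content is exactly
`hres.glob` at `n ∈ {0, 1}`, `γ = −3` plus the class transfer; Track A's `_coGlob` editions (`B9Ineq347CoReading.glob_of_hasMajorantHom`: (3.47) ⇐ (3.42) + Lemma 2.1 on the model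
operator) are the upgrade that would discharge it at T³ too.  (ii) «M sufficiently large» becomes a constraint on the MEMBER MAP: the threshold `M₄ ≤ M = L^{1+a'}` fixes the
big-block exponent `a' ≥ log_L M₄` AFTER `Thm313Printed`'s witness is opened, and then `memberIdx`'s `a' + 3 ≤ m + n` excludes the tori with fewer than `L^{a'+3}` unit sites
per direction — the recorded sub-gap (GEO-small) of RULING 01:56:50Z, now with its threshold named.
HONEST SCOPE: bookkeeping (two inequalities from one ∃-package + one monotonicity of `RegPr`); no estimate; N06(d = 3) is NOT discharged; nothing here claims EX, the crux, V3∕R3,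
d = 4 or the mass gap; YM₃ on T³ is ladder rung R3, not the Clay problem.

References: T. Bałaban, CMP 99 (1985) 389–434 [Balaban1985BackgroundPropagators] ((3.35)–(3.36) p.396, (3.41) p.397, (3.47) p.398, Thm 3.13 p.426); CMP 102 (1985) 277–309
[Balaban1985Variational] ((14) p.280, (115) p.294, (117) p.295); CMP 99 (1985) 75–102 [Balaban1985RegularSpaces] ((1.33) p.82, Prop. 6 p.99).
-/

set_option autoImplicit false

noncomputable section

open scoped Matrix.Norms.L2Operator

namespace Summit.QuantumFields.YangMills.Theorems.Prop7SectET3NormG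

open Literature.MathematicalPhysics.QuantumFieldTheory.Balaban1983to89
open Literature.MathematicalPhysics.QuantumFieldTheory.Balaban1983to89.T3ContinuumYM3Torus
open Literature.MathematicalPhysics.QuantumFieldTheory.Balaban1983to89.T3PrintedRegularMinimiser (RegPr)
open Literature.MathematicalPhysics.QuantumFieldTheory.Balaban1983to89.T3PrintedMinimiserExistence (regPr_mono)
open Literature.MathematicalPhysics.QuantumFieldTheory.Balaban1983to89.B6KLevelCensusIndexV1 (KIdx kGeo)
open Literature.MathematicalPhysics.QuantumFieldTheory.Balaban1983to89.B6GlobalChartV1 (PV)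
open Literature.MathematicalPhysics.QuantumFieldTheory.Balaban1983to89.B9GeoNormsKLevelV1 (geo9K)
open Literature.MathematicalPhysics.QuantumFieldTheory.Balaban1983to89.B11Eq115Space (NegSize Space115 JetSup)
open Summit.QuantumFields.YangMills.Theorems.Prop7SectET3Members (hd3 memberIdx)
open Summit.QuantumFields.YangMills.Theorems.Prop7SectET3BgClass (bgT3 cfgV1OfT3 ClassTransferT3)

/-! ## §1 Generic: `norm_G`'s sentence from `Thm313Printed`'s (3.47)₁ at `γ = −3` -/

section Generic

variable {I : Type} {c35 : ℝ} {geo : I → B9.Geometry} {bg : I → B9.Backgrounds} {GG : ∀ i, B9.KernelFamily (geo i) (bg i)}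
  {HasRWExp : ∀ i, B9.KernelFamily (geo i) (bg i) → (bg i).Cfg → ℝ → Prop} {PosDefK : ∀ i, B9.KernelFamily (geo i) (bg i) → (bg i).Cfg → Prop}

/-- ★ **`norm_G` FROM THEOREM 3.13's GLOBAL CLAUSE (3.47)₁ AT `γ = −3`, GENERIC.**  Data: a background-indexed family of maps `Gop i U : X i U → Y i U` between seminormed groups
(at the T³ instance: `𝔊(U₀) : |·|₍₋₃₎ → (115)_{U₀}`), a reading `ι i U : X i U → (geo i).Loc` of its arguments as (3.41)-arguments, and the two PINS displayed as inequalities: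
`hw` — the reading does not increase the size `|·|_{(−3)}` (`(geo i).wNorm (−3) (ι f) ≤ ‖f‖`); `hglob` — the target norm of `Gop i U f` is read by the two (3.47) entries
`n = 0` (`|𝔊λ|_{(2+γ)}`) and `n = 1` (`|∇_U𝔊λ|_{(1+γ)}`) at `γ = −3` (the (115) jet norm `max{|A|₍₋₁₎, |∇_{U}A|₍₋₂₎}`).  Conclusion: the `∃`-package of `B9.Thm313Printed` delivers
`M₄, a₀, B₀ > 0` with `‖Gop i U f‖ ≤ B₀‖f‖` for every member above the M-threshold, every `0 < α₀` with `M·α₀ ≤ a₀` and every `U` in (3.35) ∩ (3.36) — the text of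
`SectEDatum.norm_G` ∕ (117). [cite: Balaban1985BackgroundPropagators, (3.47) p.398, Thm 3.13 p.426; Balaban1985Variational, (117) p.295] -/
theorem normG_of_thm313Printed (h313 : B9.Thm313Printed c35 geo bg GG HasRWExp PosDefK)
    {X Y : ∀ i : I, (bg i).Cfg → Type} [∀ i U, SeminormedAddCommGroup (X i U)] [∀ i U, SeminormedAddCommGroup (Y i U)]
    (Gop : ∀ (i : I) (U : (bg i).Cfg), X i U → Y i U) (ι : ∀ (i : I) (U : (bg i).Cfg), X i U → (geo i).Loc)
    (hw : ∀ (i : I) (U : (bg i).Cfg) (f : X i U), (geo i).wNorm (-3) (ι i U f) ≤ ‖f‖)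
    (hglob : ∀ (i : I) (U : (bg i).Cfg) (f : X i U), ‖Gop i U f‖ ≤ max ((GG i).glob 0 U (ι i U f) (-3)) ((GG i).glob 1 U (ι i U f) (-3))) :
    ∃ M₄ a₀ B₀ : ℝ, 0 < M₄ ∧ 0 < a₀ ∧ 0 < B₀ ∧
      ∀ i : I, M₄ ≤ (geo i).M → ∀ α₀ : ℝ, 0 < α₀ → (geo i).M * α₀ ≤ a₀ →
        ∀ U : (bg i).Cfg, (bg i).Reg335 c35 α₀ U → (bg i).Reg336 c35 α₀ U → ∀ f : X i U, ‖Gop i U f‖ ≤ B₀ * ‖f‖ := by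
  obtain ⟨M₄, δ₀, a₀, B₀, Bβ, Bε, Bεβ, hM₄, _hδ₀, ha₀, hB₀, h⟩ := h313
  refine ⟨M₄, a₀, B₀, hM₄, ha₀, hB₀, fun i hM α₀ hα₀ hMa U hU hU' f => ?_⟩
  have hgl := (h i hM α₀ hα₀ hMa U hU hU').1.2.2
  have h0 : (GG i).glob 0 U (ι i U f) (-3) ≤ B₀ * ‖f‖ :=
    (hgl 0 (ι i U f) (-3) (by decide) (by norm_num) (by norm_num)).trans (mul_le_mul_of_nonneg_left (hw i U f) hB₀.le)
  have h1 : (GG i).glob 1 U (ι i U f) (-3) ≤ B₀ * ‖f‖ :=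
    (hgl 1 (ι i U f) (-3) (by decide) (by norm_num) (by norm_num)).trans (mul_le_mul_of_nonneg_left (hw i U f) hB₀.le)
  exact (hglob i U f).trans (max_le h0 h1)

/-- **The same in the (115) letters**: `Y i U := Space115 (Lr i) (η i) (lev₀ i) (lev₁ i) (D i U)` (the jet space of [Balaban1985Variational] (115) at the background's covariant
derivative `D i U`), the two pins on the two jet components — `‖JetSup.fst (Gop i U f)‖ = |𝔊f|₍₋₁₎ ≤ glob 0 … (−3)` and `‖JetSup.snd (Gop i U f)‖ = |D(𝔊f)|₍₋₂₎ ≤ glob 1 … (−3)`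
(`JetSup.norm_def : ‖A‖ = max ‖fst A‖ ‖snd A‖`). [cite: Balaban1985Variational, (115) p.294, (117) p.295; Balaban1985BackgroundPropagators, (3.47) p.398] -/
theorem normG_of_thm313Printed_jet (h313 : B9.Thm313Printed c35 geo bg GG HasRWExp PosDefK)
    {X : ∀ i : I, (bg i).Cfg → Type} [∀ i U, SeminormedAddCommGroup (X i U)]
    {V : Type} [NormedAddCommGroup V] [NormedSpace ℂ V] {P₀ P₁ : I → Type} [∀ i, Fintype (P₀ i)] [∀ i, Fintype (P₁ i)]
    (Lr η : I → ℝ) [∀ i, Fact (0 < Lr i)] [∀ i, Fact (0 < η i)] (lev₀ : ∀ i, P₀ i → ℕ) (lev₁ : ∀ i, P₁ i → ℕ)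
    (D : ∀ (i : I) (_U : (bg i).Cfg), (P₀ i → V) →ₗ[ℂ] (P₁ i → V))
    (Gop : ∀ (i : I) (U : (bg i).Cfg), X i U → Space115 (Lr i) (η i) (lev₀ i) (lev₁ i) (D i U)) (ι : ∀ (i : I) (U : (bg i).Cfg), X i U → (geo i).Loc)
    (hw : ∀ (i : I) (U : (bg i).Cfg) (f : X i U), (geo i).wNorm (-3) (ι i U f) ≤ ‖f‖)
    (hglob0 : ∀ (i : I) (U : (bg i).Cfg) (f : X i U), ‖JetSup.fst (Gop i U f)‖ ≤ (GG i).glob 0 U (ι i U f) (-3))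
    (hglob1 : ∀ (i : I) (U : (bg i).Cfg) (f : X i U), ‖JetSup.snd (Gop i U f)‖ ≤ (GG i).glob 1 U (ι i U f) (-3)) :
    ∃ M₄ a₀ B₀ : ℝ, 0 < M₄ ∧ 0 < a₀ ∧ 0 < B₀ ∧
      ∀ i : I, M₄ ≤ (geo i).M → ∀ α₀ : ℝ, 0 < α₀ → (geo i).M * α₀ ≤ a₀ →
        ∀ U : (bg i).Cfg, (bg i).Reg335 c35 α₀ U → (bg i).Reg336 c35 α₀ U →
          ∀ f : X i U, ‖Gop i U f‖ ≤ B₀ * ‖f‖ :=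
  -- the implicit carrier letters of `JetSup.norm_le_iff` are given through `f` (else the unifier unfolds the norm instances)
  normG_of_thm313Printed h313 Gop ι hw fun i U f =>
    (JetSup.norm_le_iff (f := Gop i U f)).2 ⟨(hglob0 i U f).trans (le_max_left _ _), (hglob1 i U f).trans (le_max_right _ _)⟩

end Generic

/-! ## §2 At the T³ member of record: the displayed `norm_G` row's shape through the class-transfer row -/

section T3

variable {ℓ : ℕ} {hL : Odd (ℓ + 1) ∧ 1 < ℓ + 1} {c35 : ℝ} {GG : ∀ i : KIdx 2 ℓ hd3 hL 1 1, B9.KernelFamily (geo9K i) (bgT3 i)}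
  {HasRWExp : ∀ i : KIdx 2 ℓ hd3 hL 1 1, B9.KernelFamily (geo9K i) (bgT3 i) → (bgT3 i).Cfg → ℝ → Prop}
  {PosDefK : ∀ i : KIdx 2 ℓ hd3 hL 1 1, B9.KernelFamily (geo9K i) (bgT3 i) → (bgT3 i).Cfg → Prop}

/-- The member's cube-size letter in `geo9K`: `(geo9K (memberIdx …)).M = L·L^{a'}` (`= (kGeo _).M`, ★w1 g2's `M_memberIdx`). [cite: Balaban1985BackgroundPropagators, p.396 («O(1)M is a size of □»)] -/
theorem geo9K_M_memberIdx (hℓ : 4 ≤ ℓ) (m : ℕ) (hm : 1 ≤ m) (n K a' R : ℕ) (hk1 : 1 ≤ K - n) (hsize : a' + 3 ≤ m + n) (hM8 : 8 ≤ (ℓ + 1) ^ a')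
    (hR2 : 2 * (ℓ + 1) ^ 2 ≤ R) :
    (geo9K (memberIdx ℓ hL hℓ m hm n K a' R hk1 hsize hM8 hR2)).M = ((ℓ + 1 : ℕ) : ℝ) * (((ℓ + 1) ^ a' : ℕ) : ℝ) := rfl

/-- The member's cube-size letter is positive. [cite: Balaban1985BackgroundPropagators, p.396 (bookkeeping)] -/
theorem geo9K_M_memberIdx_pos (hℓ : 4 ≤ ℓ) (m : ℕ) (hm : 1 ≤ m) (n K a' R : ℕ) (hk1 : 1 ≤ K - n) (hsize : a' + 3 ≤ m + n) (hM8 : 8 ≤ (ℓ + 1) ^ a')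
    (hR2 : 2 * (ℓ + 1) ^ 2 ≤ R) :
    0 < (geo9K (memberIdx ℓ hL hℓ m hm n K a' R hk1 hsize hM8 hR2)).M := by
  rw [geo9K_M_memberIdx]
  positivity

/-- ★★ **THE DISPLAYED `norm_G` ROW AT THE T³ MEMBER OF RECORD FROM `Thm313Printed` ∧ `ClassTransferT3` ∧ THE TWO (3.47) PINS.**  At the index `KIdx 2 ℓ hd3 hL 1 1` (★w3-20520 g2),
geometry `geo9K`, backgrounds `bgT3` (★w1 g2), a background-indexed operator family `Gop i U : X i U → Y i U` read by `GG`'s (3.47) entries at `γ = −3` (`hglob`, `hw` as in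
§1): `B9.Thm313Printed c35 geo9K bgT3 GG …` (the conclusion of `Prop7SectET3N06Leaves.t313_of_pins_T3`) and the class-transfer row `ClassTransferT3 ℓ hL c35` give
`M₄, a₀, B₀ > 0` such that for every member `memberIdx ℓ hL hℓ m hm n K a' R …` with `M₄ ≤ L·L^{a'}`, every `e ≤ a₀∕(L·L^{a'})` and every SU(2) field `U₀` of the member's torus
in print's regular space `RegPr ⟨ℓ+1, hL, m, hm⟩ n K e U₀`:  `‖Gop (memberIdx …) (cfgV1OfT3 U₀) f‖ ≤ B₀‖f‖` for all `f` — the displayed `norm_G` row of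
`Cmin_of_P6T3_chart_growth_pd` in its own shape (`RegPr … e U₀ → e ≤ α → …`, `α = a₀∕(L·L^{a'})` member-uniform once `a'` is fixed).  Inside: `RegPr e ⊂ RegPr α`
(`regPr_mono`), `α = L³·1·(α∕L³)` for the class-transfer row, `M·α = a₀`. [cite: Balaban1985Variational, (117) p.295, (14) p.280; Balaban1985BackgroundPropagators, Thm 3.13 p.426, (3.47) p.398; Balaban1985RegularSpaces, (1.33) p.82] -/
theorem normG_row_of_t313_classTransfer (h313 : B9.Thm313Printed c35 geo9K bgT3 GG HasRWExp PosDefK) (hCT : ClassTransferT3 ℓ hL c35)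
    {X Y : ∀ i : KIdx 2 ℓ hd3 hL 1 1, (bgT3 i).Cfg → Type} [∀ i U, SeminormedAddCommGroup (X i U)] [∀ i U, SeminormedAddCommGroup (Y i U)]
    (Gop : ∀ (i : KIdx 2 ℓ hd3 hL 1 1) (U : (bgT3 i).Cfg), X i U → Y i U) (ι : ∀ (i : KIdx 2 ℓ hd3 hL 1 1) (U : (bgT3 i).Cfg), X i U → (geo9K i).Loc)
    (hw : ∀ (i : KIdx 2 ℓ hd3 hL 1 1) (U : (bgT3 i).Cfg) (f : X i U), (geo9K i).wNorm (-3) (ι i U f) ≤ ‖f‖)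
    (hglob : ∀ (i : KIdx 2 ℓ hd3 hL 1 1) (U : (bgT3 i).Cfg) (f : X i U), ‖Gop i U f‖ ≤ max ((GG i).glob 0 U (ι i U f) (-3)) ((GG i).glob 1 U (ι i U f) (-3))) :
    ∃ M₄ a₀ B₀ : ℝ, 0 < M₄ ∧ 0 < a₀ ∧ 0 < B₀ ∧
      ∀ (hℓ : 4 ≤ ℓ) (m : ℕ) (hm : 1 ≤ m) (n K a' R : ℕ) (hk1 : 1 ≤ K - n) (hsize : a' + 3 ≤ m + n) (hM8 : 8 ≤ (ℓ + 1) ^ a') (hR2 : 2 * (ℓ + 1) ^ 2 ≤ R),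
        M₄ ≤ ((ℓ + 1 : ℕ) : ℝ) * (((ℓ + 1) ^ a' : ℕ) : ℝ) →
        ∀ (e : ℝ) (U₀ : GaugeField (PV 2 ℓ m K hd3 hL) 0 (Matrix.specialUnitaryGroup (Fin 2) ℂ)),
          RegPr (⟨ℓ + 1, hL, m, hm⟩ : T3Family) n K e U₀ → e ≤ a₀ / (((ℓ + 1 : ℕ) : ℝ) * (((ℓ + 1) ^ a' : ℕ) : ℝ)) →
            ∀ f : X (memberIdx ℓ hL hℓ m hm n K a' R hk1 hsize hM8 hR2) (cfgV1OfT3 U₀),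
              ‖Gop (memberIdx ℓ hL hℓ m hm n K a' R hk1 hsize hM8 hR2) (cfgV1OfT3 U₀) f‖ ≤ B₀ * ‖f‖ := by
  obtain ⟨M₄, a₀, B₀, hM₄, ha₀, hB₀, h⟩ := normG_of_thm313Printed h313 Gop ι hw hglob
  refine ⟨M₄, a₀, B₀, hM₄, ha₀, hB₀, fun hℓ m hm n K a' R hk1 hsize hM8 hR2 hM e U₀ hreg he f => ?_⟩
  set i := memberIdx ℓ hL hℓ m hm n K a' R hk1 hsize hM8 hR2 with hi
  have hMpos : 0 < ((ℓ + 1 : ℕ) : ℝ) * (((ℓ + 1) ^ a' : ℕ) : ℝ) := by positivity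
  have hL3 : 0 < ((ℓ + 1 : ℕ) : ℝ) ^ 3 := by positivity
  -- the member-uniform radius `α = a₀ / M` and its class-transfer form `L³·1·(α/L³)`
  set α : ℝ := a₀ / (((ℓ + 1 : ℕ) : ℝ) * (((ℓ + 1) ^ a' : ℕ) : ℝ)) with hα
  have hαpos : 0 < α := div_pos ha₀ hMpos
  have hαeq : ((ℓ + 1 : ℕ) : ℝ) ^ 3 * 1 * (α / ((ℓ + 1 : ℕ) : ℝ) ^ 3) = α := by
    field_simp
  have hreg' : RegPr (⟨ℓ + 1, hL, m, hm⟩ : T3Family) n K (((ℓ + 1 : ℕ) : ℝ) ^ 3 * 1 * (α / ((ℓ + 1 : ℕ) : ℝ) ^ 3)) U₀ := by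
    rw [hαeq]
    exact regPr_mono _ he hreg
  have hcls := hCT hℓ m hm n K a' R hk1 hsize hM8 hR2 1 (α / ((ℓ + 1 : ℕ) : ℝ) ^ 3) one_pos (div_pos hαpos hL3) U₀ hreg'
  rw [hαeq] at hcls
  have hMα : (geo9K i).M * α ≤ a₀ := by
    rw [hi, geo9K_M_memberIdx, hα, mul_div_cancel₀ _ hMpos.ne']
  exact h i (by rw [hi, geo9K_M_memberIdx]; exact hM) α hαpos hMα (cfgV1OfT3 U₀) hcls.1 hcls.2 f

end T3

end Summit.QuantumFields.YangMills.Theorems.Prop7SectET3NormG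

end
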